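import Summits.CriticalPhenomena.PercolationContinuityZ3.Theorems.Transplant.SkelPhiNegReachRoomsCxK
import Summits.CriticalPhenomena.PercolationContinuityZ3.Theorems.Transplant.SkelPhiNegReachRoomsCyK
import HarnessLib

/-!
# N1 (the `{±1}` node), (C) column under (ζ′) — file (C-S9g-K): THE BAND ROOMS BY CORRIDOR AXIS WITH THE BOX MULTIPLIER `kq` (the twin of
# `SkelPhiNegReachRoomsC` (C-S9g, p302364); NEG-SCOPE §B.19 (ζ′): one cell = `20·r = 800·kq` strides) — the hypotheses `hrdB'`, `hrdB`, `hrdL`,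
# `zB/hzB/hZ/hrdZ` of `reachOblRHN_negSG₂b_of_inputs` at the record values `CorrRec.*` and the band count `800kq − 1`, assembled from the x-band facts
# (C-S9d-K) for a u-corridor (`du.1 = 0`) and the y′-band facts (C-S9e/f-K) for a v-corridor (`du.1 = 1`): **`CorrRec.hrdC1K / hrdC0K`** (regions,
# with / without margin), **`CorrRec.hrdLCK`** (last core in the arrival box `cen' ± (b₀ − 1)`), the y′-band habitat points **`zByK kq n ℓ h v σ j :=
# (σ·j'·v, σ·j'·W_B)`**, `j' = min j (800kq)` (membership, size `≤ 800kq·(n + W_B)`, rooms — the twin of `SkelPhiNegReachRoomsCyL` §4), **`CorrRec.zBK`**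
# (habitat points by axis) with **`zBK_mem`**, **`zBK_l1`** (`Zmax := 800kq·(n + W_B)`) and **`hrdZCK`**, under the union of the band floors (`hbx1–3`,
# `hby1–3`) and target floors (`hxL1`, `hxL3`, `hyL1–3`) in the (ζ′) scale. The case `kq = 1` is the record (C-S9f §4 / C-S9g).

builds on p205010 (kernel theorem, internal audit signed; external expert review pending) — nothing in this file uses p205010; nothing here is a
claim about the open node `SamePDropOfSkeletonNeg₁`.
Lane `prim-bschramm`, seat `prim-bschramm-p5` (gen 11; (C) lineage); helper file (`--supports stmt-CriticalPhenomena-4575`).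
[cite: KozmaNitzan2024, §4 Lemma 11 (p. 22), Lemma 12 (pp. 23–25), p. 26 (M_v, H_{v,x})] [cite: MartineauTassion2017, §4.3 Lemma 4.2]
-/

noncomputable section

namespace Summit.CriticalPhenomena.PercolationContinuityZ3.Theorems

namespace Transplant

namespace Skelφ

namespace CorrRec

open Literature.Probability.Percolation Literature.Probability.LatticeModels
open Literature.Probability.Percolation.KozmaNitzan.Cells (oth oth_ne sgOf sgOf_sign eq_oth_of_ne)
open TwoAxis.Para (modulus)
open ChainPlanar ChainPara

/-- `oth 1 = 0` on `Fin 2`. [folklore] -/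
private theorem oth_one' : oth (1 : Fin 2) = 0 := by decide

section YBandPts

variable {kq : ℕ} {A : ℤ} {n : ℕ} {h v vβ c₀' c₁' D : ℤ} {P : PCells2} {ℓ T : ℕ} {aW bL : ℤ}

/-! ## §4 The habitat points of the y′-band cores -/

/-- **The habitat point of core `j` of the y′-band under (ζ′)**: `(σ·j'·v, σ·j'·W_B)`, `j' = min j (800·kq)`. [this work] -/
def zByK (kq n ℓ : ℕ) (h v : ℤ) (σ : ℤ) (j : ℕ) : Site 2 := ![σ * ((min j (800 * kq) : ℕ) : ℤ) * v, σ * ((min j (800 * kq) : ℕ) : ℤ) * (Qw n ℓ h : ℕ)]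

/-- The coordinates of the habitat point. [folklore] -/
theorem zByK_apply (kq n ℓ : ℕ) (h v σ : ℤ) (j : ℕ) :
    zByK kq n ℓ h v σ j 0 = σ * ((min j (800 * kq) : ℕ) : ℤ) * v ∧ zByK kq n ℓ h v σ j 1 = σ * ((min j (800 * kq) : ℕ) : ℤ) * (Qw n ℓ h : ℕ) := ⟨rfl, rfl⟩

/-- **The habitat point of core `j ≤ 800kq` lies in core `j`** of the y′-band. [folklore] -/
theorem zByK_mem (hn : 1 ≤ n) (hkq : 1 ≤ kq) {du : MDir} (hd : du.1 = 1) {j : ℕ} (hj1 : 1 ≤ j)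
    (hj : j ≤ (bandNw n ℓ h v T n (800 * kq - 1) (qy n ℓ h v T aW bL) (800 * kq - 1) (qy n ℓ h v T aW bL) (Wmy n v) (Wpy n v) du).N + 1) :
    zByK kq n ℓ h v (sgOf du) j ∈ (bandNw n ℓ h v T n (800 * kq - 1) (qy n ℓ h v T aW bL) (800 * kq - 1) (qy n ℓ h v T aW bL) (Wmy n v) (Wpy n v) du).pcore du.1 (sgOf du) 0 j := by
  have _h := hj1
  rw [bandNw_yK (n := n) (ℓ := ℓ) (h := h) (v := v) (T := T) (aW := aW) (bL := bL) hd] at hj ⊢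
  obtain ⟨haLo, haHi, hbLo, hbHi, -, -, -, -, hN⟩ := cornersYK (n := n) (h := h) (v := v) (ℓ := ℓ) (T := T) (aW := aW) (bL := bL) j
  rw [hN] at hj
  have hjm : (min j (800 * kq) : ℕ) = j := min_eq_left (by have := NCk_spec hkq; omega)
  have hσσ : sgOf du * sgOf du = 1 := by rcases sgOf_sign du with hs | hs <;> simp [hs]
  have hQ : ((Qw n ℓ h : ℕ) : ℤ) = (n : ℤ) * ℓ / (shearUnit n h : ℕ) + 1 := by unfold Qw; push_cast; rfl
  obtain ⟨hs1, hs2⟩ := sA_bounds hn ℓ h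
  rw [hd, RunPrm.mem_pcore_iff (sgOf_sign du)]
  simp only [RunPrm.InCore, Pi.zero_apply, sub_zero, oth_one', (zByK_apply kq n ℓ h v (sgOf du) j).1, (zByK_apply kq n ℓ h v (sgOf du) j).2, hjm,
    haLo, haHi, hbLo, hbHi]
  have e1 : sgOf du * (sgOf du * (j : ℤ) * (Qw n ℓ h : ℕ)) = (j : ℤ) * (Qw n ℓ h : ℕ) := by
    calc sgOf du * (sgOf du * (j : ℤ) * (Qw n ℓ h : ℕ)) = (sgOf du * sgOf du) * ((j : ℤ) * (Qw n ℓ h : ℕ)) := by ring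
      _ = (j : ℤ) * (Qw n ℓ h : ℕ) := by rw [hσσ, one_mul]
  have e0 : sgOf du * (sgOf du * (j : ℤ) * v) = (j : ℤ) * v := by
    calc sgOf du * (sgOf du * (j : ℤ) * v) = (sgOf du * sgOf du) * ((j : ℤ) * v) := by ring
      _ = (j : ℤ) * v := by rw [hσσ, one_mul]
  rw [e1, e0, ← hQ]
  have hT0 : (0 : ℤ) ≤ T := by positivity
  have hq0 : (0 : ℤ) ≤ (qy n ℓ h v T aW bL : ℕ) := by positivity
  have hj0 : (0 : ℤ) ≤ j := by positivity
  have hWm0 : (0 : ℤ) ≤ ((Wmy n v : ℕ) : ℤ) := by positivity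
  have hWp0 : (0 : ℤ) ≤ ((Wpy n v : ℕ) : ℤ) := by positivity
  have hjT : 0 ≤ (j : ℤ) * T := by positivity
  have hjs : (j : ℤ) * sA n ℓ h ≤ (j : ℤ) * (Qw n ℓ h : ℕ) := mul_le_mul_of_nonneg_left (by linarith) hj0
  refine ⟨by linarith, by linarith, by linarith, by linarith⟩

/-- **The habitat points are within `800kq·(n + W_B)` of the origin** (in `ℓ¹`, `|v| ≤ n`). [folklore] -/
theorem zByK_l1 (hvn : |v| ≤ n) (σ : ℤ) (hσ : σ = 1 ∨ σ = -1) (j : ℕ) :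
    ((zByK kq n ℓ h v σ j) 0).natAbs + ((zByK kq n ℓ h v σ j) 1).natAbs ≤ 800 * kq * (n + Qw n ℓ h) := by
  rw [(zByK_apply kq n ℓ h v σ j).1, (zByK_apply kq n ℓ h v σ j).2]
  have hm : (min j (800 * kq) : ℕ) ≤ 800 * kq := min_le_right _ _
  have hσ1 : σ.natAbs = 1 := by rcases hσ with rfl | rfl <;> simp
  have hv' : v.natAbs ≤ n := by
    have := hvn; rw [← Int.natCast_natAbs] at this; exact_mod_cast this
  rw [Int.natAbs_mul, Int.natAbs_mul, Int.natAbs_mul, Int.natAbs_mul, hσ1, Int.natAbs_natCast, Int.natAbs_natCast, one_mul]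
  have h1 : (min j (800 * kq) : ℕ) * v.natAbs ≤ 800 * kq * n := Nat.mul_le_mul hm hv'
  have h2 : (min j (800 * kq) : ℕ) * Qw n ℓ h ≤ 800 * kq * Qw n ℓ h := Nat.mul_le_mul_right _ hm
  rw [Nat.mul_add]; exact Nat.add_le_add h1 h2

set_option maxHeartbeats 400000 in
/-- **The habitat points of the y′-band read inside the rooms with one unit of margin**, either sign, under the band floors.
[cite: KozmaNitzan2024, §4 p. 26 (H_{v,x})] -/
theorem roomsZyK (hn : 1 ≤ n) (hA : 0 < A) (hD : 0 < D) (hm : 0 < modulus n h v vβ) (hc₀ : 0 < c₀') (hkq : 1 ≤ kq)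
    (hsc0 : c₀' * A * (40 * (kq : ℤ) * modulus n h v vβ) = (P.r 0 : ℤ) * D) (hsc1 : c₁' * A * (40 * (kq : ℤ) * modulus n h v vβ) = (P.r 1 : ℤ) * D)
    (hr40 : ∀ i, 40 * (kq : ℤ) ≤ (P.r i : ℤ))
    (hΔlo : (n : ℤ) * ℓ - n < modulus n h v vβ) (hΔhi : modulus n h v vβ ≤ (n : ℤ) * ℓ)
    (hby1 : (shearUnit n h : ℤ) * (((qy n ℓ h v T aW bL : ℕ) : ℤ) + 800 * (kq : ℤ) * T + (3 * (n * ℓ) / shearUnit n h + 1 : ℕ) + 1) + 2 * modulus n h v vβ ≤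
      40 * (kq : ℤ) * 5 * modulus n h v vβ)
    (hby2 : (shearUnit n h : ℤ) * ((800 * (kq : ℤ) - 1) * ((Qw n ℓ h : ℕ) : ℤ) + (qy n ℓ h v T aW bL : ℕ) + 800 * (kq : ℤ) * T + (3 * (n * ℓ) / shearUnit n h + 1 : ℕ) + 1) +
      2 * modulus n h v vβ ≤ 40 * (kq : ℤ) * 22 * modulus n h v vβ)
    (hby3 : (P.r 0 : ℤ) * (modulus n h v vβ * (((Wmy n v : ℕ) : ℤ) + (Wpy n v : ℕ) + 800 * (kq : ℤ) * T + n) +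
        |v| * ((shearUnit n h : ℤ) * ((2400 * (kq : ℤ) - 3 + ((qy n ℓ h v T aW bL : ℕ) : ℤ) + 800 * (kq : ℤ) * T + (3 * (n * ℓ) / shearUnit n h + 1 : ℕ)) + 1)) +
        |v| * (800 * (kq : ℤ) * (n + (shearUnit n h : ℤ)))) + 40 * (kq : ℤ) * modulus n h v vβ * n + (P.r 0 : ℤ) * n ≤ 40 * (kq : ℤ) * modulus n h v vβ * (n * (2 * (P.r 0 : ℤ))))
    {du : MDir} (hd : du.1 = 1) (j : ℕ) :
    (sgOf du = 1 → -(5 * (P.r du.1 : ℤ)) + 1 ≤ rdLo A n h v vβ c₀' c₁' D (zByK kq n ℓ h v (sgOf du) j) (zByK kq n ℓ h v (sgOf du) j) du.1 ∧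
      rdHi A n h v vβ c₀' c₁' D (zByK kq n ℓ h v (sgOf du) j) (zByK kq n ℓ h v (sgOf du) j) du.1 ≤ 22 * (P.r du.1 : ℤ) - 1) ∧
    (sgOf du = -1 → -(5 * (P.r du.1 : ℤ)) + 1 ≤ -rdHi A n h v vβ c₀' c₁' D (zByK kq n ℓ h v (sgOf du) j) (zByK kq n ℓ h v (sgOf du) j) du.1 ∧
      -rdLo A n h v vβ c₀' c₁' D (zByK kq n ℓ h v (sgOf du) j) (zByK kq n ℓ h v (sgOf du) j) du.1 ≤ 22 * (P.r du.1 : ℤ) - 1) ∧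
    (-(2 * (P.r (oth du.1) : ℤ)) + 1 ≤ rdLo A n h v vβ c₀' c₁' D (zByK kq n ℓ h v (sgOf du) j) (zByK kq n ℓ h v (sgOf du) j) (oth du.1) ∧
      rdHi A n h v vβ c₀' c₁' D (zByK kq n ℓ h v (sgOf du) j) (zByK kq n ℓ h v (sgOf du) j) (oth du.1) ≤ 2 * (P.r (oth du.1) : ℤ) - 1) := by
  rw [hd, oth_one']
  obtain ⟨e0, e1⟩ := zByK_apply kq n ℓ h v (sgOf du) j
  set Q : ℤ := ((Qw n ℓ h : ℕ) : ℤ) with hQdef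
  set qY : ℤ := ((qy n ℓ h v T aW bL : ℕ) : ℤ) with hqY
  set La : ℤ := ((3 * (n * ℓ) / shearUnit n h + 1 : ℕ) : ℤ) with hLadef
  set m8 : ℤ := ((min j (800 * kq) : ℕ) : ℤ) with hm8
  have hΔ : (0 : ℤ) < modulus n h v vβ := hm
  have hn0 : (0 : ℤ) ≤ n := by positivity
  have hU : (0 : ℤ) ≤ (shearUnit n h : ℤ) := by positivity
  have hv0 : (0 : ℤ) ≤ |v| := abs_nonneg v
  have hjm : m8 ≤ 800 * (kq : ℤ) := by rw [hm8]; exact_mod_cast min_le_right j (800 * kq)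
  have hj0 : (0 : ℤ) ≤ m8 := by positivity
  have hj8 : (min j (800 * kq) : ℕ) ≤ 800 * kq := min_le_right _ _
  have hT0 : (0 : ℤ) ≤ T := by positivity
  have hq0 : (0 : ℤ) ≤ qY := by positivity
  have hLa0 : (0 : ℤ) ≤ La := by positivity
  have hQ0 : (0 : ℤ) ≤ Q := by positivity
  have hQq : Q ≤ qY := by rw [hQdef, hqY]; exact_mod_cast Qw_le_qy n ℓ h v T aW bL
  have hr0 : (0 : ℤ) ≤ P.r 0 := by positivity
  have hWm0 : (0 : ℤ) ≤ ((Wmy n v : ℕ) : ℤ) := by positivity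
  have hWp0 : (0 : ℤ) ≤ ((Wpy n v : ℕ) : ℤ) := by positivity
  -- the point budgets from the band floors
  have hkT0 : 0 ≤ 800 * (kq : ℤ) * T := by positivity
  have pb1 : (shearUnit n h : ℤ) * 0 + 2 * modulus n h v vβ ≤ 40 * (kq : ℤ) * 5 * modulus n h v vβ := by
    have : (0 : ℤ) ≤ (shearUnit n h : ℤ) * (qY + 800 * (kq : ℤ) * T + La + 1) := by positivity
    linarith [hby1]
  have pb1' : (shearUnit n h : ℤ) * (0 + 1) + 2 * modulus n h v vβ ≤ 40 * (kq : ℤ) * 5 * modulus n h v vβ := by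
    have : (shearUnit n h : ℤ) * 1 ≤ (shearUnit n h : ℤ) * (qY + 800 * (kq : ℤ) * T + La + 1) := mul_le_mul_of_nonneg_left (by linarith) hU
    linarith [hby1]
  have pb2 : (shearUnit n h : ℤ) * (800 * (kq : ℤ) * Q + 1) + 2 * modulus n h v vβ ≤ 40 * (kq : ℤ) * 22 * modulus n h v vβ := by
    have e : (800 * (kq : ℤ) - 1) * Q + qY = 800 * (kq : ℤ) * Q + (qY - Q) := by ring
    have : (shearUnit n h : ℤ) * (800 * (kq : ℤ) * Q + 1) ≤ (shearUnit n h : ℤ) * ((800 * (kq : ℤ) - 1) * Q + qY + 800 * (kq : ℤ) * T + La + 1) :=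
      mul_le_mul_of_nonneg_left (by rw [e]; linarith) hU
    linarith [hby2]
  have pb2' : (shearUnit n h : ℤ) * (800 * (kq : ℤ) * Q) + 2 * modulus n h v vβ ≤ 40 * (kq : ℤ) * 22 * modulus n h v vβ := by
    have : (shearUnit n h : ℤ) * (800 * (kq : ℤ) * Q) ≤ (shearUnit n h : ℤ) * (800 * (kq : ℤ) * Q + 1) := mul_le_mul_of_nonneg_left (by linarith) hU
    linarith [pb2]
  have pb3 : (P.r 0 : ℤ) * (modulus n h v vβ * 0 + |v| * ((shearUnit n h : ℤ) * (0 + 1)) + |v| * (800 * (kq : ℤ) * (n + (shearUnit n h : ℤ)))) +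
      40 * (kq : ℤ) * modulus n h v vβ * n + (P.r 0 : ℤ) * n ≤ 40 * (kq : ℤ) * modulus n h v vβ * (n * (2 * (P.r 0 : ℤ))) := by
    have h1 : modulus n h v vβ * 0 ≤ modulus n h v vβ * (((Wmy n v : ℕ) : ℤ) + (Wpy n v : ℕ) + 800 * (kq : ℤ) * T + n) := by
      rw [mul_zero]; positivity
    have hk3 : (0 : ℤ) ≤ 2400 * (kq : ℤ) - 3 := by
      have : (1 : ℤ) ≤ kq := by exact_mod_cast hkq
      linarith
    have h2 : |v| * ((shearUnit n h : ℤ) * (0 + 1)) ≤ |v| * ((shearUnit n h : ℤ) * ((2400 * (kq : ℤ) - 3 + qY + 800 * (kq : ℤ) * T + La) + 1)) :=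
      mul_le_mul_of_nonneg_left (mul_le_mul_of_nonneg_left (by linarith) hU) hv0
    have h3 := mul_le_mul_of_nonneg_left (add_le_add (add_le_add h1 h2) (le_refl (|v| * (800 * (kq : ℤ) * (n + (shearUnit n h : ℤ)))))) hr0
    linarith [hby3]
  have hjQ : m8 * Q ≤ 800 * (kq : ℤ) * Q := mul_le_mul_of_nonneg_right hjm hQ0
  have hjQ0 : 0 ≤ m8 * Q := mul_nonneg hj0 hQ0
  rcases sgOf_sign du with hs | hs
  · have g1 : zByK kq n ℓ h v (sgOf du) j 1 = m8 * Q := by rw [e1, hs, one_mul]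
    have g0 : zByK kq n ℓ h v (sgOf du) j 0 = v * (1 * m8) := by rw [e0, hs]; ring
    have hanch := anchor_leK hn ℓ hΔlo hΔhi hkq (Or.inl rfl : (1 : ℤ) = 1 ∨ (1 : ℤ) = -1) hj8
    have k1 := readLo1_of_budgetK (A := A) (c₀' := c₀') (D := D) hD hm hkq hsc1 hr40 (lo := zByK kq n ℓ h v (sgOf du) j) (hi := zByK kq n ℓ h v (sgOf du) j) (m := 5)
      (B := 0) (by rw [g1]; linarith) pb1
    have k2 := readHi1_of_budgetK (A := A) (c₀' := c₀') (D := D) hD hm hkq hsc1 hr40 (lo := zByK kq n ℓ h v (sgOf du) j) (hi := zByK kq n ℓ h v (sgOf du) j) (m := 22)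
      (B := 800 * (kq : ℤ) * Q) (by rw [g1]; exact hjQ) pb2
    have k3 := readAcross0_driftK (c₁' := c₁') hn hA hD hm hc₀ hkq hsc0 (lo := zByK kq n ℓ h v (sgOf du) j) (hi := zByK kq n ℓ h v (sgOf du) j) (t := 1 * m8) (B := 0)
      (c := 1 * m8 * Q) (ρ := 0) (E := 800 * (kq : ℤ) * (n + (shearUnit n h : ℤ))) (Y := 2 * (P.r 0 : ℤ))
      (by rw [g0]; linarith) (by rw [g0]; linarith) (by rw [g1]; simp) (by rw [g1]; simp) (by rw [hm8]; exact hanch) pb3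
    exact ⟨fun _ => ⟨by linarith only [k1], by linarith only [k2]⟩, fun h1 => absurd (hs.symm.trans h1) (by norm_num), by linarith only [k3.1], by linarith only [k3.2]⟩
  · have g1 : zByK kq n ℓ h v (sgOf du) j 1 = -(m8 * Q) := by rw [e1, hs]; ring
    have g0 : zByK kq n ℓ h v (sgOf du) j 0 = v * (-1 * m8) := by rw [e0, hs]; ring
    have hanch := anchor_leK hn ℓ hΔlo hΔhi hkq (Or.inr rfl : (-1 : ℤ) = 1 ∨ (-1 : ℤ) = -1) hj8
    have k1 := readHi1_of_budgetK (A := A) (c₀' := c₀') (D := D) hD hm hkq hsc1 hr40 (lo := zByK kq n ℓ h v (sgOf du) j) (hi := zByK kq n ℓ h v (sgOf du) j) (m := 5)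
      (B := 0) (by rw [g1]; linarith) pb1'
    have k2 := readLo1_of_budgetK (A := A) (c₀' := c₀') (D := D) hD hm hkq hsc1 hr40 (lo := zByK kq n ℓ h v (sgOf du) j) (hi := zByK kq n ℓ h v (sgOf du) j) (m := 22)
      (B := 800 * (kq : ℤ) * Q) (by rw [g1]; linarith) pb2'
    have k3 := readAcross0_driftK (c₁' := c₁') hn hA hD hm hc₀ hkq hsc0 (lo := zByK kq n ℓ h v (sgOf du) j) (hi := zByK kq n ℓ h v (sgOf du) j) (t := -1 * m8) (B := 0)
      (c := -1 * m8 * Q) (ρ := 0) (E := 800 * (kq : ℤ) * (n + (shearUnit n h : ℤ))) (Y := 2 * (P.r 0 : ℤ))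
      (by rw [g0]; linarith) (by rw [g0]; linarith) (by rw [g1]; ring_nf; simp) (by rw [g1]; ring_nf; simp) (by rw [hm8]; exact hanch) pb3
    exact ⟨fun h1 => absurd (hs.symm.trans h1) (by norm_num), fun _ => ⟨by linarith only [k1], by linarith only [k2]⟩, by linarith only [k3.1], by linarith only [k3.2]⟩


end YBandPts

section Combine

variable {kq : ℕ} {A : ℤ} {n : ℕ} {h v vβ c₀' c₁' D : ℤ} {P : PCells2} {ℓ T : ℕ} {aW bL : ℤ}

/-- **The structure holding the union of the band and target floors** is avoided: the floors are passed one by one. The REGIONS of the band with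
one unit of margin (`hrdB'` of `reachOblRHN_negSG₂b_of_inputs`). [cite: KozmaNitzan2024, §4 Lemma 11 (p. 22), Lemma 12 (pp. 23–25)] -/
theorem hrdC1K (hn : 1 ≤ n) (hA : 0 < A) (hD : 0 < D) (hm : 0 < modulus n h v vβ) (hc₀ : 0 < c₀')
    (hkq : 1 ≤ kq)
    (hsc0 : c₀' * A * (40 * (kq : ℤ) * modulus n h v vβ) = (P.r 0 : ℤ) * D) (hsc1 : c₁' * A * (40 * (kq : ℤ) * modulus n h v vβ) = (P.r 1 : ℤ) * D)
    (hr40 : ∀ i, 40 * (kq : ℤ) ≤ (P.r i : ℤ))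
    (hΔlo : (n : ℤ) * ℓ - n < modulus n h v vβ) (hΔhi : modulus n h v vβ ≤ (n : ℤ) * ℓ) (hsT : (T : ℤ) + 1 ≤ sA n ℓ h)
    (hbx1 : modulus n h v vβ * (2 * n + 800 * (kq : ℤ) * T) + |v| * ((shearUnit n h : ℤ) * ((qy n ℓ h v T aW bL : ℕ) + 800 * (kq : ℤ) * T + (3 * (n * ℓ) / shearUnit n h + 1 : ℕ) + 1))
      + 3 * modulus n h v vβ * n ≤ 40 * (kq : ℤ) * 5 * modulus n h v vβ * n)
    (hbx2 : modulus n h v vβ * ((800 * (kq : ℤ) + 1) * n + 800 * (kq : ℤ) * T) + |v| * ((shearUnit n h : ℤ) * ((qy n ℓ h v T aW bL : ℕ) + 800 * (kq : ℤ) * T + (3 * (n * ℓ) / shearUnit n h + 1 : ℕ) + 1))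
      + 3 * modulus n h v vβ * n ≤ 40 * (kq : ℤ) * 22 * modulus n h v vβ * n)
    (hbx3 : (shearUnit n h : ℤ) * ((qy n ℓ h v T aW bL : ℕ) + 800 * (kq : ℤ) * T + (3 * (n * ℓ) / shearUnit n h + 1 : ℕ) + 1) + 2 * modulus n h v vβ ≤
      40 * (kq : ℤ) * 2 * modulus n h v vβ)
    (hby1 : (shearUnit n h : ℤ) * (((qy n ℓ h v T aW bL : ℕ) : ℤ) + 800 * (kq : ℤ) * T + (3 * (n * ℓ) / shearUnit n h + 1 : ℕ) + 1) + 2 * modulus n h v vβ ≤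
      40 * (kq : ℤ) * 5 * modulus n h v vβ)
    (hby2 : (shearUnit n h : ℤ) * ((800 * (kq : ℤ) - 1) * ((Qw n ℓ h : ℕ) : ℤ) + (qy n ℓ h v T aW bL : ℕ) + 800 * (kq : ℤ) * T + (3 * (n * ℓ) / shearUnit n h + 1 : ℕ) + 1) +
      2 * modulus n h v vβ ≤ 40 * (kq : ℤ) * 22 * modulus n h v vβ)
    (hby3 : (P.r 0 : ℤ) * (modulus n h v vβ * (((Wmy n v : ℕ) : ℤ) + (Wpy n v : ℕ) + 800 * (kq : ℤ) * T + n) +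
        |v| * ((shearUnit n h : ℤ) * ((2400 * (kq : ℤ) - 3 + ((qy n ℓ h v T aW bL : ℕ) : ℤ) + 800 * (kq : ℤ) * T + (3 * (n * ℓ) / shearUnit n h + 1 : ℕ)) + 1)) +
        |v| * (800 * (kq : ℤ) * (n + (shearUnit n h : ℤ)))) + 40 * (kq : ℤ) * modulus n h v vβ * n + (P.r 0 : ℤ) * n ≤ 40 * (kq : ℤ) * modulus n h v vβ * (n * (2 * (P.r 0 : ℤ)))) :
    ∀ du : MDir, ∀ j ≤ (bandNw n ℓ h v T n (800 * kq - 1) (qy n ℓ h v T aW bL) (800 * kq - 1) (qy n ℓ h v T aW bL) (Wmy n v) (Wpy n v) du).N,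
      let Bd := bandNw n ℓ h v T n (800 * kq - 1) (qy n ℓ h v T aW bL) (800 * kq - 1) (qy n ℓ h v T aW bL) (Wmy n v) (Wpy n v) du
      let lo := dLo du.1 (sgOf du) 0 (Bd.aLo j - Bd.ea - Bd.La) (Bd.aHi j + Bd.ea + Bd.La) (Bd.bLo j - Bd.eb - Bd.Lb) (Bd.bHi j + Bd.eb + Bd.Lb)
      let hi := dHi du.1 (sgOf du) 0 (Bd.aLo j - Bd.ea - Bd.La) (Bd.aHi j + Bd.ea + Bd.La) (Bd.bLo j - Bd.eb - Bd.Lb) (Bd.bHi j + Bd.eb + Bd.Lb)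
      (sgOf du = 1 → -(5 * (P.r du.1 : ℤ)) + 1 ≤ rdLo A n h v vβ c₀' c₁' D lo hi du.1 ∧ rdHi A n h v vβ c₀' c₁' D lo hi du.1 ≤ 22 * (P.r du.1 : ℤ) - 1) ∧
      (sgOf du = -1 → -(5 * (P.r du.1 : ℤ)) + 1 ≤ -rdHi A n h v vβ c₀' c₁' D lo hi du.1 ∧ -rdLo A n h v vβ c₀' c₁' D lo hi du.1 ≤ 22 * (P.r du.1 : ℤ) - 1) ∧
      (-(2 * (P.r (oth du.1) : ℤ)) + 1 ≤ rdLo A n h v vβ c₀' c₁' D lo hi (oth du.1) ∧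
        rdHi A n h v vβ c₀' c₁' D lo hi (oth du.1) ≤ 2 * (P.r (oth du.1) : ℤ) - 1) := by
  intro du j hj
  rw [bandNw_NK] at hj
  by_cases hd : du.1 = 0
  · exact roomsBxK hn hA hD hm hc₀ hkq hsc0 hsc1 hr40 hbx1 hbx2 hbx3 hd hj
  · exact roomsByK hn hA hD hm hc₀ hkq hsc0 hsc1 hr40 hΔlo hΔhi hsT hby1 hby2 hby3 (fst_eq_one_of_ne_zero hd) hj

/-- **The REGIONS of the band without margin** (`hrdB` of `reachOblRHN_negSG₂b`). [cite: KozmaNitzan2024, §4 Lemma 12] -/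
theorem hrdC0K (hn : 1 ≤ n) (hA : 0 < A) (hD : 0 < D) (hm : 0 < modulus n h v vβ) (hc₀ : 0 < c₀')
    (hkq : 1 ≤ kq)
    (hsc0 : c₀' * A * (40 * (kq : ℤ) * modulus n h v vβ) = (P.r 0 : ℤ) * D) (hsc1 : c₁' * A * (40 * (kq : ℤ) * modulus n h v vβ) = (P.r 1 : ℤ) * D)
    (hr40 : ∀ i, 40 * (kq : ℤ) ≤ (P.r i : ℤ))
    (hΔlo : (n : ℤ) * ℓ - n < modulus n h v vβ) (hΔhi : modulus n h v vβ ≤ (n : ℤ) * ℓ) (hsT : (T : ℤ) + 1 ≤ sA n ℓ h)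
    (hbx1 : modulus n h v vβ * (2 * n + 800 * (kq : ℤ) * T) + |v| * ((shearUnit n h : ℤ) * ((qy n ℓ h v T aW bL : ℕ) + 800 * (kq : ℤ) * T + (3 * (n * ℓ) / shearUnit n h + 1 : ℕ) + 1))
      + 3 * modulus n h v vβ * n ≤ 40 * (kq : ℤ) * 5 * modulus n h v vβ * n)
    (hbx2 : modulus n h v vβ * ((800 * (kq : ℤ) + 1) * n + 800 * (kq : ℤ) * T) + |v| * ((shearUnit n h : ℤ) * ((qy n ℓ h v T aW bL : ℕ) + 800 * (kq : ℤ) * T + (3 * (n * ℓ) / shearUnit n h + 1 : ℕ) + 1))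
      + 3 * modulus n h v vβ * n ≤ 40 * (kq : ℤ) * 22 * modulus n h v vβ * n)
    (hbx3 : (shearUnit n h : ℤ) * ((qy n ℓ h v T aW bL : ℕ) + 800 * (kq : ℤ) * T + (3 * (n * ℓ) / shearUnit n h + 1 : ℕ) + 1) + 2 * modulus n h v vβ ≤
      40 * (kq : ℤ) * 2 * modulus n h v vβ)
    (hby1 : (shearUnit n h : ℤ) * (((qy n ℓ h v T aW bL : ℕ) : ℤ) + 800 * (kq : ℤ) * T + (3 * (n * ℓ) / shearUnit n h + 1 : ℕ) + 1) + 2 * modulus n h v vβ ≤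
      40 * (kq : ℤ) * 5 * modulus n h v vβ)
    (hby2 : (shearUnit n h : ℤ) * ((800 * (kq : ℤ) - 1) * ((Qw n ℓ h : ℕ) : ℤ) + (qy n ℓ h v T aW bL : ℕ) + 800 * (kq : ℤ) * T + (3 * (n * ℓ) / shearUnit n h + 1 : ℕ) + 1) +
      2 * modulus n h v vβ ≤ 40 * (kq : ℤ) * 22 * modulus n h v vβ)
    (hby3 : (P.r 0 : ℤ) * (modulus n h v vβ * (((Wmy n v : ℕ) : ℤ) + (Wpy n v : ℕ) + 800 * (kq : ℤ) * T + n) +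
        |v| * ((shearUnit n h : ℤ) * ((2400 * (kq : ℤ) - 3 + ((qy n ℓ h v T aW bL : ℕ) : ℤ) + 800 * (kq : ℤ) * T + (3 * (n * ℓ) / shearUnit n h + 1 : ℕ)) + 1)) +
        |v| * (800 * (kq : ℤ) * (n + (shearUnit n h : ℤ)))) + 40 * (kq : ℤ) * modulus n h v vβ * n + (P.r 0 : ℤ) * n ≤ 40 * (kq : ℤ) * modulus n h v vβ * (n * (2 * (P.r 0 : ℤ)))) :
    ∀ du : MDir, ∀ j ≤ (bandNw n ℓ h v T n (800 * kq - 1) (qy n ℓ h v T aW bL) (800 * kq - 1) (qy n ℓ h v T aW bL) (Wmy n v) (Wpy n v) du).N,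
      let Bd := bandNw n ℓ h v T n (800 * kq - 1) (qy n ℓ h v T aW bL) (800 * kq - 1) (qy n ℓ h v T aW bL) (Wmy n v) (Wpy n v) du
      let lo := dLo du.1 (sgOf du) 0 (Bd.aLo j - Bd.ea - Bd.La) (Bd.aHi j + Bd.ea + Bd.La) (Bd.bLo j - Bd.eb - Bd.Lb) (Bd.bHi j + Bd.eb + Bd.Lb)
      let hi := dHi du.1 (sgOf du) 0 (Bd.aLo j - Bd.ea - Bd.La) (Bd.aHi j + Bd.ea + Bd.La) (Bd.bLo j - Bd.eb - Bd.Lb) (Bd.bHi j + Bd.eb + Bd.Lb)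
      (sgOf du = 1 → -(5 * (P.r du.1 : ℤ)) ≤ rdLo A n h v vβ c₀' c₁' D lo hi du.1 ∧ rdHi A n h v vβ c₀' c₁' D lo hi du.1 ≤ 22 * (P.r du.1 : ℤ)) ∧
      (sgOf du = -1 → -(5 * (P.r du.1 : ℤ)) ≤ -rdHi A n h v vβ c₀' c₁' D lo hi du.1 ∧ -rdLo A n h v vβ c₀' c₁' D lo hi du.1 ≤ 22 * (P.r du.1 : ℤ)) ∧
      (-(2 * (P.r (oth du.1) : ℤ)) ≤ rdLo A n h v vβ c₀' c₁' D lo hi (oth du.1) ∧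
        rdHi A n h v vβ c₀' c₁' D lo hi (oth du.1) ≤ 2 * (P.r (oth du.1) : ℤ)) := by
  intro du j hj
  obtain ⟨a, b, c⟩ := hrdC1K hn hA hD hm hc₀ hkq hsc0 hsc1 hr40 hΔlo hΔhi hsT hbx1 hbx2 hbx3 hby1 hby2 hby3 du j hj
  exact ⟨fun hs => ⟨by linarith [(a hs).1], by linarith [(a hs).2]⟩, fun hs => ⟨by linarith [(b hs).1], by linarith [(b hs).2]⟩,
    by linarith [c.1], by linarith [c.2]⟩

/-- **The LAST CORE of the band lies in the next cell's arrival box `cen' ± (b₀ − 1)`** (`hrdL`), either axis and sign, under the target floors.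
[cite: KozmaNitzan2024, §4 Lemma 12 (pp. 23–25), p. 26 (M_v)] -/
theorem hrdLCK (hn : 1 ≤ n) (hA : 0 < A) (hD : 0 < D) (hm : 0 < modulus n h v vβ) (hc₀ : 0 < c₀')
    (hkq : 1 ≤ kq)
    (hsc0 : c₀' * A * (40 * (kq : ℤ) * modulus n h v vβ) = (P.r 0 : ℤ) * D) (hsc1 : c₁' * A * (40 * (kq : ℤ) * modulus n h v vβ) = (P.r 1 : ℤ) * D)
    (hΔlo : (n : ℤ) * ℓ - n < modulus n h v vβ) (hΔhi : modulus n h v vβ ≤ (n : ℤ) * ℓ) (b₀ : Fin 2 → ℕ)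
    (hxL1 : 40 * (kq : ℤ) * modulus n h v vβ * n * (20 * (P.r 0 : ℤ) - (b₀ 0 : ℕ) + 1) + (P.r 0 : ℤ) * n +
      (P.r 0 : ℤ) * (|v| * ((shearUnit n h : ℤ) * ((qy n ℓ h v T aW bL : ℕ) + 800 * (kq : ℤ) * T + 1))) ≤ (P.r 0 : ℤ) * (modulus n h v vβ * ((800 * (kq : ℤ) - 1) * n - 800 * (kq : ℤ) * T)))
    (hxL3 : (P.r 1 : ℤ) * ((shearUnit n h : ℤ) * ((qy n ℓ h v T aW bL : ℕ) + 800 * (kq : ℤ) * T + 1)) + 40 * (kq : ℤ) * modulus n h v vβ ≤ 40 * (kq : ℤ) * modulus n h v vβ * (b₀ 1 : ℕ))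
    (hyL1 : 40 * (kq : ℤ) * modulus n h v vβ * (20 * (P.r 1 : ℤ) - (b₀ 1 : ℕ) + 1) + (P.r 1 : ℤ) * ((shearUnit n h : ℤ) - 1) <
      (P.r 1 : ℤ) * ((shearUnit n h : ℤ) * (800 * (kq : ℤ) * sA n ℓ h - (qy n ℓ h v T aW bL : ℕ) - 800 * (kq : ℤ) * T)))
    (hyL2 : (P.r 1 : ℤ) * ((shearUnit n h : ℤ) * (800 * (kq : ℤ) * ((Qw n ℓ h : ℕ) : ℤ) + (qy n ℓ h v T aW bL : ℕ) + 800 * (kq : ℤ) * T) + shearUnit n h - 1) <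
      40 * (kq : ℤ) * modulus n h v vβ * (20 * (P.r 1 : ℤ) + (b₀ 1 : ℕ) - 1))
    (hyL3 : (P.r 0 : ℤ) * (modulus n h v vβ * (((Wmy n v : ℕ) : ℤ) + (Wpy n v : ℕ) + 800 * (kq : ℤ) * T) +
        |v| * ((shearUnit n h : ℤ) * ((2400 * (kq : ℤ) + ((qy n ℓ h v T aW bL : ℕ) : ℤ) + 800 * (kq : ℤ) * T) + 1)) + |v| * (800 * (kq : ℤ) * (n + (shearUnit n h : ℤ)))) +
        40 * (kq : ℤ) * modulus n h v vβ * n + (P.r 0 : ℤ) * n ≤ 40 * (kq : ℤ) * modulus n h v vβ * (n * ((b₀ 0 : ℕ) : ℤ))) :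
    ∀ du : MDir,
      let Bd := bandNw n ℓ h v T n (800 * kq - 1) (qy n ℓ h v T aW bL) (800 * kq - 1) (qy n ℓ h v T aW bL) (Wmy n v) (Wpy n v) du
      let lo := dLo du.1 (sgOf du) 0 (Bd.aLo (Bd.N + 1)) (Bd.aHi (Bd.N + 1)) (Bd.bLo (Bd.N + 1)) (Bd.bHi (Bd.N + 1))
      let hi := dHi du.1 (sgOf du) 0 (Bd.aLo (Bd.N + 1)) (Bd.aHi (Bd.N + 1)) (Bd.bLo (Bd.N + 1)) (Bd.bHi (Bd.N + 1))
      (sgOf du = 1 → 20 * (P.r du.1 : ℤ) - (b₀ du.1 : ℕ) + 1 ≤ rdLo A n h v vβ c₀' c₁' D lo hi du.1 ∧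
        rdHi A n h v vβ c₀' c₁' D lo hi du.1 ≤ 20 * (P.r du.1 : ℤ) + (b₀ du.1 : ℕ) - 1) ∧
      (sgOf du = -1 → 20 * (P.r du.1 : ℤ) - (b₀ du.1 : ℕ) + 1 ≤ -rdHi A n h v vβ c₀' c₁' D lo hi du.1 ∧
        -rdLo A n h v vβ c₀' c₁' D lo hi du.1 ≤ 20 * (P.r du.1 : ℤ) + (b₀ du.1 : ℕ) - 1) ∧
      (-((b₀ (oth du.1) : ℕ) : ℤ) + 1 ≤ rdLo A n h v vβ c₀' c₁' D lo hi (oth du.1) ∧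
        rdHi A n h v vβ c₀' c₁' D lo hi (oth du.1) ≤ ((b₀ (oth du.1) : ℕ) : ℤ) - 1) := by
  intro du
  by_cases hd : du.1 = 0
  · exact roomsLxK hn hA hD hm hc₀ hkq hsc0 hsc1 b₀ hxL1 hxL3 hd
  · exact roomsLyK hn hA hD hm hc₀ hkq hsc0 hsc1 hΔlo hΔhi b₀ hyL1 hyL2 hyL3 (fst_eq_one_of_ne_zero hd)

/-! ## The habitat points -/

/-- **The habitat points of the band cores by corridor axis.** [this work] -/
def zBK (kq n ℓ : ℕ) (h v : ℤ) (du : MDir) (j : ℕ) : Site 2 := if du.1 = 0 then zBxK kq n (sgOf du) j else zByK kq n ℓ h v (sgOf du) j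

/-- **The habitat point of core `1 ≤ j ≤ N + 1` lies in core `j`** (`hzB`). [folklore] -/
theorem zBK_mem (hn : 1 ≤ n) (hkq : 1 ≤ kq) : ∀ (du : MDir) (j : ℕ), 1 ≤ j →
    j ≤ (bandNw n ℓ h v T n (800 * kq - 1) (qy n ℓ h v T aW bL) (800 * kq - 1) (qy n ℓ h v T aW bL) (Wmy n v) (Wpy n v) du).N + 1 →
      zBK kq n ℓ h v du j ∈ (bandNw n ℓ h v T n (800 * kq - 1) (qy n ℓ h v T aW bL) (800 * kq - 1) (qy n ℓ h v T aW bL) (Wmy n v) (Wpy n v) du).pcore du.1 (sgOf du) 0 j := by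
  intro du j hj1 hj
  by_cases hd : du.1 = 0
  · rw [zBK, if_pos hd]; exact zBxK_mem hkq hd hj1 hj
  · rw [zBK, if_neg hd]; exact zByK_mem hn hkq (fst_eq_one_of_ne_zero hd) hj1 hj

/-- **The habitat points are within `Zmax := 800kq·(n + W_B)` of the origin** (`hZ`). [folklore] -/
theorem zBK_l1 (hvn : |v| ≤ n) : ∀ (du : MDir) (j : ℕ), ((zBK kq n ℓ h v du j) 0).natAbs + ((zBK kq n ℓ h v du j) 1).natAbs ≤ 800 * kq * (n + Qw n ℓ h) := by
  intro du j
  by_cases hd : du.1 = 0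
  · rw [zBK, if_pos hd]
    exact (zBxK_l1 (sgOf du) (sgOf_sign du) j).trans (Nat.mul_le_mul_left _ (Nat.le_add_right _ _))
  · rw [zBK, if_neg hd]; exact zByK_l1 hvn (sgOf du) (sgOf_sign du) j

/-- **The habitat points read inside the rooms with one unit of margin** (`hrdZ`), either axis and sign, under the band floors.
[cite: KozmaNitzan2024, §4 p. 26 (H_{v,x})] -/
theorem hrdZCK (hn : 1 ≤ n) (hA : 0 < A) (hD : 0 < D) (hm : 0 < modulus n h v vβ) (hc₀ : 0 < c₀')
    (hkq : 1 ≤ kq)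
    (hsc0 : c₀' * A * (40 * (kq : ℤ) * modulus n h v vβ) = (P.r 0 : ℤ) * D) (hsc1 : c₁' * A * (40 * (kq : ℤ) * modulus n h v vβ) = (P.r 1 : ℤ) * D)
    (hr40 : ∀ i, 40 * (kq : ℤ) ≤ (P.r i : ℤ))
    (hΔlo : (n : ℤ) * ℓ - n < modulus n h v vβ) (hΔhi : modulus n h v vβ ≤ (n : ℤ) * ℓ)
    (hbx1 : modulus n h v vβ * (2 * n + 800 * (kq : ℤ) * T) + |v| * ((shearUnit n h : ℤ) * ((qy n ℓ h v T aW bL : ℕ) + 800 * (kq : ℤ) * T + (3 * (n * ℓ) / shearUnit n h + 1 : ℕ) + 1))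
      + 3 * modulus n h v vβ * n ≤ 40 * (kq : ℤ) * 5 * modulus n h v vβ * n)
    (hbx2 : modulus n h v vβ * ((800 * (kq : ℤ) + 1) * n + 800 * (kq : ℤ) * T) + |v| * ((shearUnit n h : ℤ) * ((qy n ℓ h v T aW bL : ℕ) + 800 * (kq : ℤ) * T + (3 * (n * ℓ) / shearUnit n h + 1 : ℕ) + 1))
      + 3 * modulus n h v vβ * n ≤ 40 * (kq : ℤ) * 22 * modulus n h v vβ * n)
    (hbx3 : (shearUnit n h : ℤ) * ((qy n ℓ h v T aW bL : ℕ) + 800 * (kq : ℤ) * T + (3 * (n * ℓ) / shearUnit n h + 1 : ℕ) + 1) + 2 * modulus n h v vβ ≤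
      40 * (kq : ℤ) * 2 * modulus n h v vβ)
    (hby1 : (shearUnit n h : ℤ) * (((qy n ℓ h v T aW bL : ℕ) : ℤ) + 800 * (kq : ℤ) * T + (3 * (n * ℓ) / shearUnit n h + 1 : ℕ) + 1) + 2 * modulus n h v vβ ≤
      40 * (kq : ℤ) * 5 * modulus n h v vβ)
    (hby2 : (shearUnit n h : ℤ) * ((800 * (kq : ℤ) - 1) * ((Qw n ℓ h : ℕ) : ℤ) + (qy n ℓ h v T aW bL : ℕ) + 800 * (kq : ℤ) * T + (3 * (n * ℓ) / shearUnit n h + 1 : ℕ) + 1) +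
      2 * modulus n h v vβ ≤ 40 * (kq : ℤ) * 22 * modulus n h v vβ)
    (hby3 : (P.r 0 : ℤ) * (modulus n h v vβ * (((Wmy n v : ℕ) : ℤ) + (Wpy n v : ℕ) + 800 * (kq : ℤ) * T + n) +
        |v| * ((shearUnit n h : ℤ) * ((2400 * (kq : ℤ) - 3 + ((qy n ℓ h v T aW bL : ℕ) : ℤ) + 800 * (kq : ℤ) * T + (3 * (n * ℓ) / shearUnit n h + 1 : ℕ)) + 1)) +
        |v| * (800 * (kq : ℤ) * (n + (shearUnit n h : ℤ)))) + 40 * (kq : ℤ) * modulus n h v vβ * n + (P.r 0 : ℤ) * n ≤ 40 * (kq : ℤ) * modulus n h v vβ * (n * (2 * (P.r 0 : ℤ)))) :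
    ∀ (du : MDir) (j : ℕ),
      (sgOf du = 1 → -(5 * (P.r du.1 : ℤ)) + 1 ≤ rdLo A n h v vβ c₀' c₁' D (zBK kq n ℓ h v du j) (zBK kq n ℓ h v du j) du.1 ∧
        rdHi A n h v vβ c₀' c₁' D (zBK kq n ℓ h v du j) (zBK kq n ℓ h v du j) du.1 ≤ 22 * (P.r du.1 : ℤ) - 1) ∧
      (sgOf du = -1 → -(5 * (P.r du.1 : ℤ)) + 1 ≤ -rdHi A n h v vβ c₀' c₁' D (zBK kq n ℓ h v du j) (zBK kq n ℓ h v du j) du.1 ∧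
        -rdLo A n h v vβ c₀' c₁' D (zBK kq n ℓ h v du j) (zBK kq n ℓ h v du j) du.1 ≤ 22 * (P.r du.1 : ℤ) - 1) ∧
      (-(2 * (P.r (oth du.1) : ℤ)) + 1 ≤ rdLo A n h v vβ c₀' c₁' D (zBK kq n ℓ h v du j) (zBK kq n ℓ h v du j) (oth du.1) ∧
        rdHi A n h v vβ c₀' c₁' D (zBK kq n ℓ h v du j) (zBK kq n ℓ h v du j) (oth du.1) ≤ 2 * (P.r (oth du.1) : ℤ) - 1) := by
  intro du j
  by_cases hd : du.1 = 0
  · rw [zBK, if_pos hd]; exact roomsZxK hn hA hD hm hc₀ hkq hsc0 hsc1 hr40 hbx1 hbx2 hbx3 hd j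
  · rw [zBK, if_neg hd]; exact roomsZyK hn hA hD hm hc₀ hkq hsc0 hsc1 hr40 hΔlo hΔhi hby1 hby2 hby3 (fst_eq_one_of_ne_zero hd) j

end Combine

end CorrRec

end Skelφ

end Transplant

end Summit.CriticalPhenomena.PercolationContinuityZ3.Theorems

end
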